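import Summits.QuantumFields.BalabanUV.T4Continuum.Support.NE3HessForm
import Summits.QuantumFields.BalabanUV.T4Continuum.Support.NE3EnergyPathEnd

/-!
# T⁴ programme, node NE3, route P2 «ENERGY CONVEXITY» — leaf L3 «C2» (typer row S5-Y3): the Wilson action along a
# GENERAL C² path `t ↦ W·exp Γ(t)` of bondwise perturbations is C², with
# `φ′(t) = dAction W_t Ψ_t` and `φ″(t) = hess W_t Ψ_t Ψ_t + dAction W_t Ψ′_t`, `W_t := vary W (Γ t) 1`,
# where `Ψ_t = e^{−Γ_t}·(e^{Γ_t})′` is the bondwise RIGHT-LOGARITHMIC VELOCITY of the path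

NE3 formalisation swarm, leaf seat `b2b-balaban-t4-ne3-formalise-leaf-03` (gen 3), row S5-Y3 of
`HOME/t4/formal/NE3/LEAVES.md` = leaf L3 «C2 — REGULARITY OF `t ↦ A(γ t)` AND ITS FIRST∕SECOND DERIVATIVE FORMULAS» of
road P2's skeleton `HOME/t4/skeletons/NE3-t4-ne3-p2.md` §2A (typer name `hasDerivAt_two_fineAction_path`).  WHY.  The
torus assembly `Support/NE3EnergyAssembly.RouteLeaves` of road P2 carries the fields `act : φ t = fineAction (vary W (Γ t) 1)
(perWin …)`, `d1 : HasDerivAt φ (φ′ t) t`, `d2 : HasDerivAt φ′ (φ″ t) t` and `split : φ″ t = Hs t (X + uu t) (X + uu t) + e t`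
for an ADMISSIBLE PATH `Γ` of direction fields (B11's chart segment `Γ(t) = Φ_W((1−t)X₀)`, which is NOT a one-parameter
subgroup: `Γ(t)` and `Γ′(t)` need not commute).  The tree so far differentiates the Wilson action only along the
exponential segments `V e^{sX}` (`T4AveragingDeficitWall.hasDerivAt_fineAction_vary`, `NE3HessForm.segment_derivData`)
and along a general path only AT A BASE TIME where `Γ(t₀) = 0` (`NE3EnergyPathEnd.hasDerivAt_fineAction_path`).  THIS
FILE supplies the general-time, general-path first AND second derivatives, in the tree's currency `dAction`∕`hess` of
`NE3HessForm` (all [folklore] matrix calculus, kernel-checked; no estimate):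

§1 one letter at a general time (`hasDerivAt_exp_neg_of_rvel`: the inverse bond variable, via Mathlib's
   `hasFDerivAt_ringInverse`; `hasDerivAt_val_stepHol_gpath`), §2 a word (`hasDerivAt_val_hol_gpath`: `d/dt W_t(Γ_w) =
   (δ_{Ψ_t} W_t)(Γ_w)·W_t(Γ_w)`), §3 **`hasDerivAt_fineAction_gpath`**: `d/dt A_{Wn}(W_t) = dAction W_t Ψ_t Wn`;
§4 the moving adjoint actions `t ↦ Ad_{P(W_t)} (Y t)` for the three partial holonomies of the plaquette word
   (`hasDerivAt_Ad_gpath₁∕₂∕₃`, the general-path twins of `NE3HessForm.hasDerivAt_Ad_vary₁∕₂∕₃` with a moving argument),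
   `hasDerivAt_curlAt_gpath`: `d/dt (d_{W_t} Ψ_t)(p) = dcurlAt W_t Ψ_t Ψ_t p + (d_{W_t} Ψ′_t)(p)`, and
   **`hasDerivAt_dAction_gpath`**: `d/dt dAction W_t Ψ_t Wn = hess W_t Ψ_t Ψ_t Wn + dAction W_t Ψ′_t Wn`;
§5 the package **`hasDerivAt_two_fineAction_path`** ∕ `path_derivData` (the `d1`∕`d2` fields with
   `φ′ t = dAction W_t (Ψ t)`, `φ″ t = hess W_t (Ψ t) (Ψ t) + dAction W_t (Ψ′ t)`, so that `split` reads
   `Hs t := ` the symmetrised `hess W_t`, `X + uu t := Ψ t`, `e t := dAction W_t (Ψ′ t)` — the INSTANTIATION on Bałaban's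
   chart path is row S5-Y8's, not this leaf's);
§6 (companion file `Support/NE3EnergyPathC2Velocity`): the DICTIONARY for the velocity hypothesis
   `hE : HasDerivAt (s ↦ exp (Γ s b)) (exp (Γ t b)·Ψ t b) t` — discharged for every differentiable bond curve by
   Duhamel's formula (`Ψ t b = ∫₀¹ e^{−rΓ_t(b)} Γ′_t(b) e^{rΓ_t(b)} dr`, tree `Literature.Analysis.Calculus.ExpDuhamel`),
   `Ψ = Γ′` at a base time `Γ t₀ = 0` and along `Γ = c(t)·X`, existence of both velocity data for bondwise C² paths,
   the corollary «the action is C² along every bondwise-C² path», and the sanity check against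
   `NE3HessForm.segment_derivData`.
NOTE on the skeleton's wording «φ′ = Σ_p −Re tr[(d_W Γ′-insertion)·W_t(∂p)]»: for a non-commuting path the inserted
velocity is the right-logarithmic `Ψ_t`, not the naive `Γ′(t)`; they coincide where `Γ_t = 0` or `[Γ_t, Γ′_t] = 0`.

HONEST FRAMING.  Finite-T⁴ bookkeeping (rung (B)+1 of the cell's ladder); exact identities of matrix calculus, NO
inequality; NOTHING is asserted about Bałaban's minimisers; «NE3-E CONDITIONAL on ⟨named structures⟩» is unchanged and
NE3 is NOT proved; spine PROVED 0∕9 unchanged; no conditional of the cell (`BetaPertH`, (B), G-an2-4) is used or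
hidden; NOT infinite volume, NOT a mass gap, NOT Clay, NOT summit progress.  ABSOLUTE RULE kept: no printed sentence is
a hypothesis (context only: [Balaban1985Variational] (26)–(27) p. 282, (47), (55) pp. 285–287, (81)–(84) p. 290;
[Balaban1985Averaging] (9) p. 18).  PLACEMENT (human rule 2026-08-19): our lemmas under
`Summits/QuantumFields/BalabanUV/`; imports the accepted `Support.NE3HessForm` (p212889), `Support.NE3EnergyPathEnd`
(p207924) BY NAME; restates nothing, moves nothing; 0 `def`.
-/

set_option autoImplicit false

open scoped BigOperators Matrix.Norms.L2Operator
open NormedSpace Finset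

namespace Summit.QuantumFields.BalabanUV.T4Continuum.NE3EnergyPathC2

open Literature.MathematicalPhysics.QuantumFieldTheory.Balaban1983to89
open B7Prop1Explicit B7Prop2Explicit MatrixLog UnitaryModel
open T4AveragingDeficitWall hiding Site Plane Plaq Bond
open AveragingDeficitTransport (dstep dhol dhol_nil dhol_cons dhol_plaqWord Ad_mul_val)
open NE3HessForm (dcurlAt dcurl dAction hessPlaqAt hessPlaq hess)

noncomputable section

variable {d : ℕ} {n : Type*} [Fintype n] [DecidableEq n]

/-! ## §1 One letter along a general path, at a general time -/

/-- `e^{−X} e^{X} = 1`. [folklore] -/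
theorem exp_neg_mul_exp_eq_one (X : Matrix n n ℂ) : exp (-X) * exp X = 1 := by
  have h := (expUnit X).inv_mul
  simpa using h

/-- `e^{X} e^{−X} = 1`. [folklore] -/
theorem exp_mul_exp_neg_eq_one (X : Matrix n n ℂ) : exp X * exp (-X) = 1 := by
  have h := (expUnit X).mul_inv
  simpa using h

/-- THE INVERSE BOND VARIABLE ALONG A GENERAL PATH: if `t ↦ e^{γ(t)}` has right-logarithmic velocity `Ψ` at `t₀`
(`(e^{γ})′ = e^{γ(t₀)}·Ψ`), then `t ↦ e^{−γ(t)} = (e^{γ(t)})⁻¹` has derivative `−Ψ·e^{−γ(t₀)}` (Mathlib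
`hasFDerivAt_ringInverse`: `D(x⁻¹)[h] = −x⁻¹ h x⁻¹`). [folklore] -/
theorem hasDerivAt_exp_neg_of_rvel {γ : ℝ → Matrix n n ℂ} {Ψ : Matrix n n ℂ} {t₀ : ℝ}
    (hE : HasDerivAt (fun t => exp (γ t)) (exp (γ t₀) * Ψ) t₀) :
    HasDerivAt (fun t => exp (-γ t)) (-(Ψ * exp (-γ t₀))) t₀ := by
  have hinv : (fun t => exp (-γ t)) = Ring.inverse ∘ fun t => exp (γ t) := by
    funext t
    simp only [Function.comp_apply]
    rw [← val_expUnit (γ t), Ring.inverse_unit, val_inv_expUnit, val_expUnit]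
  have h1 := (hasFDerivAt_ringInverse (𝕜 := ℝ) (expUnit (γ t₀))).comp_hasDerivAt t₀ hE
  rw [hinv]
  refine h1.congr_deriv ?_
  simp only [neg_apply, ContinuousLinearMap.mulLeftRight_apply, val_inv_expUnit, val_expUnit]
  rw [← mul_assoc (exp (-γ t₀)) (exp (γ t₀)) Ψ, exp_neg_mul_exp_eq_one, one_mul]

/-- **ONE LETTER** along `t ↦ W_t := W·exp Γ(t)` (tree `vary W (Γ t) 1`) at a general time `t₀`, with bondwise
right-logarithmic velocity `Ψ` at `t₀`: the transport across one letter differentiates to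
`dstep W_{t₀} Ψ · stepHol W_{t₀}` — the same shape as for the straight perturbation `W_{t₀} e^{sΨ}` at `s = 0`
(tree `hasDerivAt_val_stepHol_vary`). [folklore] -/
theorem hasDerivAt_val_stepHol_gpath (W : Site d → Fin d → (Matrix n n ℂ)ˣ)
    {Γ : ℝ → Site d → Fin d → Matrix n n ℂ} {Ψ : Site d → Fin d → Matrix n n ℂ} {t₀ : ℝ}
    (hE : ∀ y κ, HasDerivAt (fun t => exp (Γ t y κ)) (exp (Γ t₀ y κ) * Ψ y κ) t₀)
    (x : Site d) (l : Letter d) :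
    HasDerivAt (fun t : ℝ => ((stepHol (vary W (Γ t) 1) x l : (Matrix n n ℂ)ˣ) : Matrix n n ℂ))
      (dstep (vary W (Γ t₀) 1) Ψ x l * ((stepHol (vary W (Γ t₀) 1) x l : (Matrix n n ℂ)ˣ) : Matrix n n ℂ)) t₀ := by
  obtain ⟨μ, b⟩ := l
  cases b
  · -- backward letter: `exp(−Γ t b) · W(b)⁻¹`
    have hb := hasDerivAt_exp_neg_of_rvel (hE (x + Letter.vec (μ, false)) μ)
    have h := hb.mul_const ((((W (x + Letter.vec (μ, false)) μ)⁻¹ : (Matrix n n ℂ)ˣ) : Matrix n n ℂ))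
    have e1 : (fun t : ℝ => ((stepHol (vary W (Γ t) 1) x (μ, false) : (Matrix n n ℂ)ˣ) : Matrix n n ℂ))
        = fun t : ℝ => exp (-Γ t (x + Letter.vec (μ, false)) μ)
            * (((W (x + Letter.vec (μ, false)) μ)⁻¹ : (Matrix n n ℂ)ˣ) : Matrix n n ℂ) := by
      funext t
      simp only [stepHol, Bool.false_eq_true, ↓reduceIte, vary, mul_inv_rev, Units.val_mul, val_inv_expUnit,
        val_expUnit, Complex.ofReal_one, one_smul]
    rw [e1]
    refine h.congr_deriv ?_
    simp only [dstep, Bool.false_eq_true, ↓reduceIte, stepHol, vary, mul_inv_rev, Units.val_mul, val_inv_expUnit,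
      val_expUnit, Complex.ofReal_one, one_smul, neg_mul, mul_assoc]
  · -- forward letter: `W(b) · exp(Γ t b)`
    have h := (hE x μ).const_mul ((W x μ : (Matrix n n ℂ)ˣ) : Matrix n n ℂ)
    have e1 : (fun t : ℝ => ((stepHol (vary W (Γ t) 1) x (μ, true) : (Matrix n n ℂ)ˣ) : Matrix n n ℂ))
        = fun t : ℝ => ((W x μ : (Matrix n n ℂ)ˣ) : Matrix n n ℂ) * exp (Γ t x μ) := by
      funext t
      simp only [stepHol, ↓reduceIte, vary, Units.val_mul, val_expUnit, Complex.ofReal_one, one_smul]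
    rw [e1]
    refine h.congr_deriv ?_
    simp only [dstep, ↓reduceIte, stepHol]
    rw [Ad_mul_val]
    simp only [vary, Units.val_mul, val_expUnit, Complex.ofReal_one, one_smul, mul_assoc]

/-! ## §2 A word along a general path, at a general time -/

/-- **A WORD**: `d/dt W_t(Γ_w) = (δ_{Ψ} W_{t₀})(Γ_w) · W_{t₀}(Γ_w)` at `t₀`, by induction on the word as in the tree's
`hasDerivAt_val_hol_vary_word`, with §1 for the letters. [folklore] -/
theorem hasDerivAt_val_hol_gpath (W : Site d → Fin d → (Matrix n n ℂ)ˣ)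
    {Γ : ℝ → Site d → Fin d → Matrix n n ℂ} {Ψ : Site d → Fin d → Matrix n n ℂ} {t₀ : ℝ}
    (hE : ∀ y κ, HasDerivAt (fun t => exp (Γ t y κ)) (exp (Γ t₀ y κ) * Ψ y κ) t₀) :
    ∀ (w : List (Letter d)) (x : Site d),
      HasDerivAt (fun t : ℝ => ((hol (vary W (Γ t) 1) x w : (Matrix n n ℂ)ˣ) : Matrix n n ℂ))
        (dhol (vary W (Γ t₀) 1) Ψ x w * ((hol (vary W (Γ t₀) 1) x w : (Matrix n n ℂ)ˣ) : Matrix n n ℂ)) t₀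
  | [], x => by
      simp only [hol_nil, Units.val_one, dhol_nil, zero_mul]
      exact hasDerivAt_const _ _
  | l :: w, x => by
      have h := (hasDerivAt_val_stepHol_gpath W hE x l).mul (hasDerivAt_val_hol_gpath W hE w (x + l.vec))
      have e1 : (fun t : ℝ => ((hol (vary W (Γ t) 1) x (l :: w) : (Matrix n n ℂ)ˣ) : Matrix n n ℂ))
          = fun t : ℝ => ((stepHol (vary W (Γ t) 1) x l : (Matrix n n ℂ)ˣ) : Matrix n n ℂ)
              * ((hol (vary W (Γ t) 1) (x + l.vec) w : (Matrix n n ℂ)ˣ) : Matrix n n ℂ) := by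
        funext t
        rw [hol_cons, Units.val_mul]
      rw [e1]
      refine h.congr_deriv ?_
      simp only [dhol_cons, hol_cons, Units.val_mul]
      unfold Ad
      simp only [add_mul, mul_assoc, Units.inv_mul_cancel_left]

/-! ## §3 The first derivative of the Wilson action along a general path, at a general time -/

/-- One Wilson weight: `d/dt (1 − Re tr W_t(∂p)) = −Re tr((d_{W_{t₀}} Ψ)(p)·W_{t₀}(∂p))` at `t₀`. [folklore] -/
theorem hasDerivAt_wt_fhol_gpath (W : Site d → Fin d → (Matrix n n ℂ)ˣ)
    {Γ : ℝ → Site d → Fin d → Matrix n n ℂ} {Ψ : Site d → Fin d → Matrix n n ℂ} {t₀ : ℝ}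
    (hE : ∀ y κ, HasDerivAt (fun t => exp (Γ t y κ)) (exp (Γ t₀ y κ) * Ψ y κ) t₀)
    (p : T4AveragingDeficitWall.Plaq d) :
    HasDerivAt (fun t : ℝ => wt (fhol (vary W (Γ t) 1) p))
      (-nReTr (curl (vary W (Γ t₀) 1) Ψ p * ((fhol (vary W (Γ t₀) 1) p : (Matrix n n ℂ)ˣ) : Matrix n n ℂ))) t₀ := by
  have hh := hasDerivAt_val_hol_gpath W hE (plaqWord p.2.1.1 p.2.1.2) p.1
  rw [dhol_plaqWord] at hh
  have h := ((nReTrL (n := n)).hasFDerivAt.comp_hasDerivAt t₀ hh).const_sub 1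
  simpa [wt, fhol, curl, Function.comp_def] using h

/-- **THE WILSON ACTION ALONG A GENERAL PATH, AT A GENERAL TIME**: for every finite window `Wn`,
`d/dt A_{Wn}(W·exp Γ(t)) = dAction W_{t₀} Ψ Wn` at `t₀`, `Ψ` the bondwise right-logarithmic velocity at `t₀`
(general-time twin of `NE3EnergyPathEnd.hasDerivAt_fineAction_path`, which is the case `Γ(t₀) = 0`, `Ψ = Γ′(t₀)`).
[folklore] -/
theorem hasDerivAt_fineAction_gpath (W : Site d → Fin d → (Matrix n n ℂ)ˣ)
    {Γ : ℝ → Site d → Fin d → Matrix n n ℂ} {Ψ : Site d → Fin d → Matrix n n ℂ} {t₀ : ℝ}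
    (hE : ∀ y κ, HasDerivAt (fun t => exp (Γ t y κ)) (exp (Γ t₀ y κ) * Ψ y κ) t₀)
    (Wn : Finset (T4AveragingDeficitWall.Plaq d)) :
    HasDerivAt (fun t : ℝ => fineAction (vary W (Γ t) 1) Wn) (dAction (vary W (Γ t₀) 1) Ψ Wn) t₀ := by
  have h := HasDerivAt.sum (u := Wn) (x := t₀) (A := fun p t => wt (fhol (vary W (Γ t) 1) p))
    (A' := fun p => -nReTr (curl (vary W (Γ t₀) 1) Ψ p * ((fhol (vary W (Γ t₀) 1) p : (Matrix n n ℂ)ˣ) : Matrix n n ℂ)))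
    fun p _ => hasDerivAt_wt_fhol_gpath W hE p
  simpa [fineAction, dAction, Finset.sum_fn] using h

/-! ## §4 The second derivative: moving adjoint actions, the dressed curl, `dAction` -/

/-- One moving factor and a moving argument: `d/dt Ad_{A e^{γ(t)}} Y(t) = Ad_{A₀}(X₁Y₀ − Y₀X₁) + Ad_{A₀} Y′` at `t₀`,
`A₀ = A e^{γ(t₀)}`, `X₁` the right-logarithmic velocity of `e^{γ}` (twin of `NE3HessForm.hasDerivAt_Ad_vary₁`).
[folklore] -/
theorem hasDerivAt_Ad_gpath₁ (A : (Matrix n n ℂ)ˣ) {γ : ℝ → Matrix n n ℂ} {X₁ : Matrix n n ℂ}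
    {Y : ℝ → Matrix n n ℂ} {Y' : Matrix n n ℂ} {t₀ : ℝ}
    (h₁ : HasDerivAt (fun t => exp (γ t)) (exp (γ t₀) * X₁) t₀) (hY : HasDerivAt Y Y' t₀) :
    HasDerivAt (fun t : ℝ => Ad (A * expUnit (γ t)) (Y t))
      (Ad (A * expUnit (γ t₀)) (X₁ * Y t₀ - Y t₀ * X₁) + Ad (A * expUnit (γ t₀)) Y') t₀ := by
  have ha : HasDerivAt (fun t : ℝ => (A : Matrix n n ℂ) * exp (γ t)) ((A : Matrix n n ℂ) * (exp (γ t₀) * X₁)) t₀ :=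
    h₁.const_mul _
  have hc : HasDerivAt (fun t : ℝ => exp (-γ t) * ((A⁻¹ : (Matrix n n ℂ)ˣ) : Matrix n n ℂ))
      (-(X₁ * exp (-γ t₀)) * ((A⁻¹ : (Matrix n n ℂ)ˣ) : Matrix n n ℂ)) t₀ :=
    (hasDerivAt_exp_neg_of_rvel h₁).mul_const _
  have H := (ha.mul hY).mul hc
  refine (H.congr_of_eventuallyEq (Filter.Eventually.of_forall fun t => ?_)).congr_deriv ?_
  · simp only [Pi.mul_apply, Ad, Units.val_mul, mul_inv_rev, val_inv_expUnit, val_expUnit, mul_assoc]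
  · simp only [Pi.mul_apply, Ad, Units.val_mul, mul_inv_rev, val_inv_expUnit, val_expUnit, mul_sub, sub_mul,
      add_mul, neg_mul, mul_neg, mul_assoc]
    abel

/-- Two moving factors and a moving argument:
`d/dt Ad_{A e^{γ₁} B e^{γ₂}} Y = Ad_{A₀}(X₁·Ad_{B₀}Y₀ − Ad_{B₀}Y₀·X₁) + Ad_{A₀B₀}(X₂Y₀ − Y₀X₂) + Ad_{A₀B₀} Y′`
(twin of `NE3HessForm.hasDerivAt_Ad_vary₂`). [folklore] -/
theorem hasDerivAt_Ad_gpath₂ (A B : (Matrix n n ℂ)ˣ) {γ₁ γ₂ : ℝ → Matrix n n ℂ} {X₁ X₂ : Matrix n n ℂ}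
    {Y : ℝ → Matrix n n ℂ} {Y' : Matrix n n ℂ} {t₀ : ℝ}
    (h₁ : HasDerivAt (fun t => exp (γ₁ t)) (exp (γ₁ t₀) * X₁) t₀)
    (h₂ : HasDerivAt (fun t => exp (γ₂ t)) (exp (γ₂ t₀) * X₂) t₀) (hY : HasDerivAt Y Y' t₀) :
    HasDerivAt (fun t : ℝ => Ad (A * expUnit (γ₁ t) * (B * expUnit (γ₂ t))) (Y t))
      (Ad (A * expUnit (γ₁ t₀)) (X₁ * Ad (B * expUnit (γ₂ t₀)) (Y t₀) - Ad (B * expUnit (γ₂ t₀)) (Y t₀) * X₁)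
        + Ad (A * expUnit (γ₁ t₀) * (B * expUnit (γ₂ t₀))) (X₂ * Y t₀ - Y t₀ * X₂)
        + Ad (A * expUnit (γ₁ t₀) * (B * expUnit (γ₂ t₀))) Y') t₀ := by
  have ha : HasDerivAt (fun t : ℝ => (A : Matrix n n ℂ) * exp (γ₁ t)) ((A : Matrix n n ℂ) * (exp (γ₁ t₀) * X₁)) t₀ :=
    h₁.const_mul _
  have hb : HasDerivAt (fun t : ℝ => (B : Matrix n n ℂ) * exp (γ₂ t)) ((B : Matrix n n ℂ) * (exp (γ₂ t₀) * X₂)) t₀ :=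
    h₂.const_mul _
  have hc₂ : HasDerivAt (fun t : ℝ => exp (-γ₂ t) * ((B⁻¹ : (Matrix n n ℂ)ˣ) : Matrix n n ℂ))
      (-(X₂ * exp (-γ₂ t₀)) * ((B⁻¹ : (Matrix n n ℂ)ˣ) : Matrix n n ℂ)) t₀ :=
    (hasDerivAt_exp_neg_of_rvel h₂).mul_const _
  have hc₁ : HasDerivAt (fun t : ℝ => exp (-γ₁ t) * ((A⁻¹ : (Matrix n n ℂ)ˣ) : Matrix n n ℂ))
      (-(X₁ * exp (-γ₁ t₀)) * ((A⁻¹ : (Matrix n n ℂ)ˣ) : Matrix n n ℂ)) t₀ :=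
    (hasDerivAt_exp_neg_of_rvel h₁).mul_const _
  have H := (((ha.mul hb).mul hY).mul (hc₂.mul hc₁))
  refine (H.congr_of_eventuallyEq (Filter.Eventually.of_forall fun t => ?_)).congr_deriv ?_
  · simp only [Pi.mul_apply, Ad, Units.val_mul, mul_inv_rev, val_inv_expUnit, val_expUnit, mul_assoc]
  · simp only [Pi.mul_apply, Ad, Units.val_mul, mul_inv_rev, val_inv_expUnit, val_expUnit, mul_sub, sub_mul,
      mul_add, add_mul, neg_mul, mul_neg, mul_assoc]
    abel

/-- Three moving factors, the third inverted, and a moving argument: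
`d/dt Ad_{A e^{γ₁} B e^{γ₂} (C e^{γ₃})⁻¹} Y = Ad_{A₀}(X₁·Ad_{B₀C₀⁻¹}Y₀ − Ad_{B₀C₀⁻¹}Y₀·X₁)
 + Ad_{A₀B₀}((X₂ − X₃)·Ad_{C₀⁻¹}Y₀ − Ad_{C₀⁻¹}Y₀·(X₂ − X₃)) + Ad_{A₀B₀C₀⁻¹} Y′`
(twin of `NE3HessForm.hasDerivAt_Ad_vary₃`). [folklore] -/
theorem hasDerivAt_Ad_gpath₃ (A B C : (Matrix n n ℂ)ˣ) {γ₁ γ₂ γ₃ : ℝ → Matrix n n ℂ} {X₁ X₂ X₃ : Matrix n n ℂ}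
    {Y : ℝ → Matrix n n ℂ} {Y' : Matrix n n ℂ} {t₀ : ℝ}
    (h₁ : HasDerivAt (fun t => exp (γ₁ t)) (exp (γ₁ t₀) * X₁) t₀)
    (h₂ : HasDerivAt (fun t => exp (γ₂ t)) (exp (γ₂ t₀) * X₂) t₀)
    (h₃ : HasDerivAt (fun t => exp (γ₃ t)) (exp (γ₃ t₀) * X₃) t₀) (hY : HasDerivAt Y Y' t₀) :
    HasDerivAt (fun t : ℝ =>
        Ad (A * expUnit (γ₁ t) * (B * expUnit (γ₂ t)) * (C * expUnit (γ₃ t))⁻¹) (Y t))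
      (Ad (A * expUnit (γ₁ t₀))
          (X₁ * Ad (B * expUnit (γ₂ t₀) * (C * expUnit (γ₃ t₀))⁻¹) (Y t₀)
            - Ad (B * expUnit (γ₂ t₀) * (C * expUnit (γ₃ t₀))⁻¹) (Y t₀) * X₁)
        + Ad (A * expUnit (γ₁ t₀) * (B * expUnit (γ₂ t₀)))
          ((X₂ - X₃) * Ad (C * expUnit (γ₃ t₀))⁻¹ (Y t₀) - Ad (C * expUnit (γ₃ t₀))⁻¹ (Y t₀) * (X₂ - X₃))
        + Ad (A * expUnit (γ₁ t₀) * (B * expUnit (γ₂ t₀)) * (C * expUnit (γ₃ t₀))⁻¹) Y') t₀ := by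
  have ha : HasDerivAt (fun t : ℝ => (A : Matrix n n ℂ) * exp (γ₁ t)) ((A : Matrix n n ℂ) * (exp (γ₁ t₀) * X₁)) t₀ :=
    h₁.const_mul _
  have hb : HasDerivAt (fun t : ℝ => (B : Matrix n n ℂ) * exp (γ₂ t)) ((B : Matrix n n ℂ) * (exp (γ₂ t₀) * X₂)) t₀ :=
    h₂.const_mul _
  have hc₃ : HasDerivAt (fun t : ℝ => exp (-γ₃ t) * ((C⁻¹ : (Matrix n n ℂ)ˣ) : Matrix n n ℂ))
      (-(X₃ * exp (-γ₃ t₀)) * ((C⁻¹ : (Matrix n n ℂ)ˣ) : Matrix n n ℂ)) t₀ :=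
    (hasDerivAt_exp_neg_of_rvel h₃).mul_const _
  have hc : HasDerivAt (fun t : ℝ => (C : Matrix n n ℂ) * exp (γ₃ t)) ((C : Matrix n n ℂ) * (exp (γ₃ t₀) * X₃)) t₀ :=
    h₃.const_mul _
  have hc₂ : HasDerivAt (fun t : ℝ => exp (-γ₂ t) * ((B⁻¹ : (Matrix n n ℂ)ˣ) : Matrix n n ℂ))
      (-(X₂ * exp (-γ₂ t₀)) * ((B⁻¹ : (Matrix n n ℂ)ˣ) : Matrix n n ℂ)) t₀ :=
    (hasDerivAt_exp_neg_of_rvel h₂).mul_const _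
  have hc₁ : HasDerivAt (fun t : ℝ => exp (-γ₁ t) * ((A⁻¹ : (Matrix n n ℂ)ˣ) : Matrix n n ℂ))
      (-(X₁ * exp (-γ₁ t₀)) * ((A⁻¹ : (Matrix n n ℂ)ˣ) : Matrix n n ℂ)) t₀ :=
    (hasDerivAt_exp_neg_of_rvel h₁).mul_const _
  have H := ((((ha.mul hb).mul hc₃).mul hY).mul (hc.mul (hc₂.mul hc₁)))
  refine (H.congr_of_eventuallyEq (Filter.Eventually.of_forall fun t => ?_)).congr_deriv ?_
  · simp only [Pi.mul_apply, Ad, Units.val_mul, mul_inv_rev, inv_inv, val_inv_expUnit, val_expUnit, neg_neg,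
      mul_assoc]
  · simp only [Pi.mul_apply, Ad, Units.val_mul, mul_inv_rev, inv_inv, val_inv_expUnit, val_expUnit, neg_neg,
      mul_sub, sub_mul, mul_add, add_mul, neg_mul, mul_neg, mul_assoc]
    abel

/-- **THE DRESSED CURL ALONG A GENERAL PATH WITH A MOVING DIRECTION FIELD**:
`d/dt (d_{W_t} Ψ_t)(z; μ < ν) = dcurlAt W_{t₀} Ψ_{t₀} Ψ_{t₀} z μ ν + (d_{W_{t₀}} Ψ′)(z; μ < ν)` at `t₀` (general-path
twin of `NE3HessForm.hasDerivAt_curlAt_vary`, plus the term from the moving field). [folklore] -/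
theorem hasDerivAt_curlAt_gpath (W : Site d → Fin d → (Matrix n n ℂ)ˣ)
    {Γ Ψ : ℝ → Site d → Fin d → Matrix n n ℂ} {Ψ' : Site d → Fin d → Matrix n n ℂ} {t₀ : ℝ}
    (hE : ∀ y κ, HasDerivAt (fun t => exp (Γ t y κ)) (exp (Γ t₀ y κ) * Ψ t₀ y κ) t₀)
    (hΨ : ∀ y κ, HasDerivAt (fun t => Ψ t y κ) (Ψ' y κ) t₀) (z : Site d) (μ ν : Fin d) :
    HasDerivAt (fun t : ℝ => curlAt (vary W (Γ t) 1) (Ψ t) z μ ν)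
      (dcurlAt (vary W (Γ t₀) 1) (Ψ t₀) (Ψ t₀) z μ ν + curlAt (vary W (Γ t₀) 1) Ψ' z μ ν) t₀ := by
  have g₁ := hasDerivAt_Ad_gpath₁ (W z μ) (hE z μ) (hΨ z μ)
  have g₂ := hasDerivAt_Ad_gpath₂ (W z μ) (W (z + e μ) ν) (hE z μ) (hE (z + e μ) ν) (hΨ (z + e μ) ν)
  have g₃ := hasDerivAt_Ad_gpath₂ (W z μ) (W (z + e μ) ν) (hE z μ) (hE (z + e μ) ν) (hΨ (z + e ν) μ)
  have g₄ := hasDerivAt_Ad_gpath₃ (W z μ) (W (z + e μ) ν) (W (z + e ν) μ) (hE z μ) (hE (z + e μ) ν)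
    (hE (z + e ν) μ) (hΨ z ν)
  have H := ((g₁.add g₂).sub g₃).sub g₄
  refine (H.congr_of_eventuallyEq (Filter.Eventually.of_forall fun t => ?_)).congr_deriv ?_
  · simp only [Pi.add_apply, Pi.sub_apply, curlAt, vary, Complex.ofReal_one, one_smul]
  · simp only [dcurlAt, curlAt, vary, Complex.ofReal_one, one_smul]
    abel

/-- One plaquette: `d/dt (−Re tr[(d_{W_t} Ψ_t)(p′)·W_t(∂p′)]) = hessPlaqAt W_{t₀} Ψ_{t₀} Ψ_{t₀} p′ −
Re tr[(d_{W_{t₀}} Ψ′)(p′)·W_{t₀}(∂p′)]` at `t₀`. [folklore] -/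
theorem hasDerivAt_dwtAt_gpath (W : Site d → Fin d → (Matrix n n ℂ)ˣ)
    {Γ Ψ : ℝ → Site d → Fin d → Matrix n n ℂ} {Ψ' : Site d → Fin d → Matrix n n ℂ} {t₀ : ℝ}
    (hE : ∀ y κ, HasDerivAt (fun t => exp (Γ t y κ)) (exp (Γ t₀ y κ) * Ψ t₀ y κ) t₀)
    (hΨ : ∀ y κ, HasDerivAt (fun t => Ψ t y κ) (Ψ' y κ) t₀) (z : Site d) (μ ν : Fin d) :
    HasDerivAt (fun t : ℝ => -nReTr (curlAt (vary W (Γ t) 1) (Ψ t) z μ ν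
        * ((hol (vary W (Γ t) 1) z (plaqWord μ ν) : (Matrix n n ℂ)ˣ) : Matrix n n ℂ)))
      (hessPlaqAt (vary W (Γ t₀) 1) (Ψ t₀) (Ψ t₀) z μ ν
        + -nReTr (curlAt (vary W (Γ t₀) 1) Ψ' z μ ν
            * ((hol (vary W (Γ t₀) 1) z (plaqWord μ ν) : (Matrix n n ℂ)ˣ) : Matrix n n ℂ))) t₀ := by
  have hc := hasDerivAt_curlAt_gpath W hE hΨ z μ ν
  have hh := hasDerivAt_val_hol_gpath W hE (plaqWord μ ν) z
  rw [dhol_plaqWord] at hh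
  have h := hc.mul hh
  have h2 := ((nReTrL (n := n)).hasFDerivAt.comp_hasDerivAt t₀ h).neg
  refine (h2.congr_of_eventuallyEq (Filter.Eventually.of_forall fun t => ?_)).congr_deriv ?_
  · simp only [Pi.neg_apply, Function.comp_apply, Pi.mul_apply, nReTrL_apply]
  · simp only [hessPlaqAt, ← nReTrL_apply, add_mul, mul_assoc, map_add, neg_add]
    abel

/-- Indexed plaquettes: `d/dt (−Re tr[(d_{W_t} Ψ_t)(p)·W_t(∂p)]) = hessPlaq W_{t₀} Ψ_{t₀} Ψ_{t₀} p −
Re tr[(d_{W_{t₀}} Ψ′)(p)·W_{t₀}(∂p)]`. [folklore] -/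
theorem hasDerivAt_dwt_gpath (W : Site d → Fin d → (Matrix n n ℂ)ˣ)
    {Γ Ψ : ℝ → Site d → Fin d → Matrix n n ℂ} {Ψ' : Site d → Fin d → Matrix n n ℂ} {t₀ : ℝ}
    (hE : ∀ y κ, HasDerivAt (fun t => exp (Γ t y κ)) (exp (Γ t₀ y κ) * Ψ t₀ y κ) t₀)
    (hΨ : ∀ y κ, HasDerivAt (fun t => Ψ t y κ) (Ψ' y κ) t₀) (p : T4AveragingDeficitWall.Plaq d) :
    HasDerivAt (fun t : ℝ => -nReTr (curl (vary W (Γ t) 1) (Ψ t) p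
        * ((fhol (vary W (Γ t) 1) p : (Matrix n n ℂ)ˣ) : Matrix n n ℂ)))
      (hessPlaq (vary W (Γ t₀) 1) (Ψ t₀) (Ψ t₀) p
        + -nReTr (curl (vary W (Γ t₀) 1) Ψ' p * ((fhol (vary W (Γ t₀) 1) p : (Matrix n n ℂ)ˣ) : Matrix n n ℂ))) t₀ :=
  hasDerivAt_dwtAt_gpath W hE hΨ p.1 p.2.1.1 p.2.1.2

/-- **`d/dt dAction W_t Ψ_t Wn = hess W_{t₀} Ψ_{t₀} Ψ_{t₀} Wn + dAction W_{t₀} Ψ′ Wn`** — the second derivative of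
the Wilson action along a general path (general-path twin of `NE3HessForm.hasDerivAt_dAction_vary_at`: the Hessian form
on the right-logarithmic velocity PLUS the first variation in the direction of its derivative). [folklore] -/
theorem hasDerivAt_dAction_gpath (W : Site d → Fin d → (Matrix n n ℂ)ˣ)
    {Γ Ψ : ℝ → Site d → Fin d → Matrix n n ℂ} {Ψ' : Site d → Fin d → Matrix n n ℂ} {t₀ : ℝ}
    (hE : ∀ y κ, HasDerivAt (fun t => exp (Γ t y κ)) (exp (Γ t₀ y κ) * Ψ t₀ y κ) t₀)
    (hΨ : ∀ y κ, HasDerivAt (fun t => Ψ t y κ) (Ψ' y κ) t₀) (Wn : Finset (T4AveragingDeficitWall.Plaq d)) :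
    HasDerivAt (fun t : ℝ => dAction (vary W (Γ t) 1) (Ψ t) Wn)
      (hess (vary W (Γ t₀) 1) (Ψ t₀) (Ψ t₀) Wn + dAction (vary W (Γ t₀) 1) Ψ' Wn) t₀ := by
  have h := HasDerivAt.sum (u := Wn) (x := t₀)
    (A := fun p t => -nReTr (curl (vary W (Γ t) 1) (Ψ t) p
      * ((fhol (vary W (Γ t) 1) p : (Matrix n n ℂ)ˣ) : Matrix n n ℂ)))
    (A' := fun p => hessPlaq (vary W (Γ t₀) 1) (Ψ t₀) (Ψ t₀) p
      + -nReTr (curl (vary W (Γ t₀) 1) Ψ' p * ((fhol (vary W (Γ t₀) 1) p : (Matrix n n ℂ)ˣ) : Matrix n n ℂ)))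
    fun p _ => hasDerivAt_dwt_gpath W hE hΨ p
  have h' : HasDerivAt (fun t : ℝ => ∑ p ∈ Wn, -nReTr (curl (vary W (Γ t) 1) (Ψ t) p
        * ((fhol (vary W (Γ t) 1) p : (Matrix n n ℂ)ˣ) : Matrix n n ℂ)))
      (∑ p ∈ Wn, (hessPlaq (vary W (Γ t₀) 1) (Ψ t₀) (Ψ t₀) p
        + -nReTr (curl (vary W (Γ t₀) 1) Ψ' p * ((fhol (vary W (Γ t₀) 1) p : (Matrix n n ℂ)ˣ) : Matrix n n ℂ)))) t₀ := by
    simpa [Finset.sum_fn] using h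
  refine (h'.congr_of_eventuallyEq (Filter.Eventually.of_forall fun t => ?_)).congr_deriv ?_
  · simp only [dAction, Finset.sum_neg_distrib]
  · simp only [hess, dAction, Finset.sum_add_distrib, Finset.sum_neg_distrib]

/-! ## §5 The package: the fields `d1`∕`d2` of `NE3EnergyAssembly.RouteLeaves` for a general path -/

/-- **LEAF L3 «C2» (typer `hasDerivAt_two_fineAction_path`).**  Along a general path `t ↦ W_t := W·exp Γ(t)` of
bondwise perturbations with bondwise right-logarithmic velocity field `Ψ t` (`hE`) whose own bondwise derivative is
`Ψ′ t` (`hΨ`), the Wilson action `φ(t) = A_{Wn}(W_t)` of any finite window is twice differentiable at every `t`, with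
  `φ′(t) = dAction W_t (Ψ t) Wn`  and  `φ″(t) = hess W_t (Ψ t) (Ψ t) Wn + dAction W_t (Ψ′ t) Wn`.
[folklore] -/
theorem hasDerivAt_two_fineAction_path (W : Site d → Fin d → (Matrix n n ℂ)ˣ)
    {Γ Ψ Ψ' : ℝ → Site d → Fin d → Matrix n n ℂ}
    (hE : ∀ t y κ, HasDerivAt (fun s => exp (Γ s y κ)) (exp (Γ t y κ) * Ψ t y κ) t)
    (hΨ : ∀ t y κ, HasDerivAt (fun s => Ψ s y κ) (Ψ' t y κ) t)
    (Wn : Finset (T4AveragingDeficitWall.Plaq d)) (t : ℝ) :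
    HasDerivAt (fun s : ℝ => fineAction (vary W (Γ s) 1) Wn) (dAction (vary W (Γ t) 1) (Ψ t) Wn) t ∧
      HasDerivAt (fun s : ℝ => dAction (vary W (Γ s) 1) (Ψ s) Wn)
        (hess (vary W (Γ t) 1) (Ψ t) (Ψ t) Wn + dAction (vary W (Γ t) 1) (Ψ' t) Wn) t :=
  ⟨hasDerivAt_fineAction_gpath W (hE t) Wn, hasDerivAt_dAction_gpath W (hE t) (hΨ t) Wn⟩

/-- The same on `[0,1]`, in the two-clause form of `NE3HessForm.segment_derivData` ∕ the fields `d1`, `d2` of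
`NE3EnergyAssembly.RouteLeaves` (with `φ t := fineAction (vary W (Γ t) 1) Wn`, `φ′ t := dAction (vary W (Γ t) 1) (Ψ t) Wn`,
`φ″ t := hess (vary W (Γ t) 1) (Ψ t) (Ψ t) Wn + dAction (vary W (Γ t) 1) (Ψ′ t) Wn`). [folklore] -/
theorem path_derivData (W : Site d → Fin d → (Matrix n n ℂ)ˣ)
    {Γ Ψ Ψ' : ℝ → Site d → Fin d → Matrix n n ℂ}
    (hE : ∀ t y κ, HasDerivAt (fun s => exp (Γ s y κ)) (exp (Γ t y κ) * Ψ t y κ) t)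
    (hΨ : ∀ t y κ, HasDerivAt (fun s => Ψ s y κ) (Ψ' t y κ) t)
    (Wn : Finset (T4AveragingDeficitWall.Plaq d)) :
    (∀ t ∈ Set.Icc (0 : ℝ) 1,
        HasDerivAt (fun s : ℝ => fineAction (vary W (Γ s) 1) Wn) (dAction (vary W (Γ t) 1) (Ψ t) Wn) t) ∧
      (∀ t ∈ Set.Icc (0 : ℝ) 1,
        HasDerivAt (fun s : ℝ => dAction (vary W (Γ s) 1) (Ψ s) Wn)
          (hess (vary W (Γ t) 1) (Ψ t) (Ψ t) Wn + dAction (vary W (Γ t) 1) (Ψ' t) Wn) t) :=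
  ⟨fun t _ => (hasDerivAt_two_fineAction_path W hE hΨ Wn t).1,
    fun t _ => (hasDerivAt_two_fineAction_path W hE hΨ Wn t).2⟩

end

end Summit.QuantumFields.BalabanUV.T4Continuum.NE3EnergyPathC2
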